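import Summits.HodgeConjecture.HodgeConjecture.Theorems.MarkmanPartnerTransportK3Sq2KugaSatakeMixedClassMap
import Summits.HodgeConjecture.HodgeConjecture.Theorems.MarkmanPartnerTransportPicardThreeK3SquaresKugaSatakePairPresentation
import Summits.HodgeConjecture.HodgeConjecture.Theorems.MarkmanPartnerTransportK3Sq2KugaSatakeSelfDescentHK

/-!
# Route MarkmanPartnerTransport · support `PartnerTransport` (stmt-HodgeConjecture-19650) ∕ crux #4 —
# programme «KS-MIXED», step M1: the MIXED presentation — a K3-type SURFACE `S` and a marked `K3^{[2]}`-type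
# FOURFOLD `X` presented on ONE abstract Hodge structure along a rational transcendental Hodge map `H²(S) → H²(X)`

Twin of gen 15's `…KugaSatakePairPresentation` (two surfaces) and `…K3Sq2KugaSatakeSelfPresentationHK` (one
fourfold) for the partner situation of the route (`PartnerTransport`: projective K3 `S`, `K3^{[2]}`-type `X`,
`g : H²(S(ℂ); ℂ) → H²(X(ℂ); ℂ)` rational, type-preserving, with `q`-transcendental image):

* `apply_mem_of_isTranscendentalPart_of_irreducible₂` — a morphism of weight-two Hodge structures `H → H'` maps an
  irreducible sub-Hodge structure `T ⊆ H` with `T^{2,0} ≠ 0` into the transcendental part `T' ⊆ H'`;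
* `exists_isTranscendentalPartBetti_trPart` — the surface presentation `(T(S)_ℚ, ε∫, T ↪ H²_B(S))` of gen 14 with
  the extra clause «`T` is THE transcendental part of `H²_B(S)`»;
* `exists_hom_ofRatClass_eq_SX` / `exists_hom_ofRatClass_eq_XS` — rational type-preserving maps
  `H²(S) → H²(X)` / `H²(X) → H²(S)` descend to morphisms `H²_B(S) → H²_B(X)` / `H²_B(X) → H²_B(S)`;
* `exists_hom_transcendental_SX` / `_XS` — restrictions `g_T : T(S)_ℚ → T(X)_ℚ`, `h_T : T(X)_ℚ → T(S)_ℚ`;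
* `apply_baseChange_eq_SX`, `bbfTransc_of_baseChange`, `hom_transcendental_bijective_SX` — `g_T` is BIJECTIVE
  when `g` maps `T(S)_ℂ` injectively onto `T(X)_ℂ`.
The multiplier and the transported presentations follow in `…K3Sq2KugaSatakeMixedMultiplier`.

THEOREMS ONLY; no sorry, no definition, no named fact; nothing here says HC or any item is proved. Prover seat
hodge-nonav-19652-p1 (gen 16), `--supports stmt-HodgeConjecture-19650` (blueprint «KS-MIXED», HOME/HANDOFF
§ 19652-p1 g15).

References: M. Varesco, Math. Z. 305 (2023) §4 (proof of Thm. 4.5), Cor. 4.6, Rem. 5.5; S. Floccari,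
arXiv:2210.02948 §5.1; C. Voisin, *Hodge Theory I* §7.1.1, §7.3.1, Lemma 7.25; D. Huybrechts, *Lectures on K3
Surfaces* Ch. 3 Def. 2.5, Lemma 2.7, Lemma 3.1, §3.3; B. van Geemen (2000) §10.1–10.2.
-/

set_option linter.dupNamespace false

noncomputable section

namespace Summit.HodgeConjecture.HodgeConjecture.Theorems.MarkmanPartnerTransport.KugaSatakeMixed

open scoped TensorProduct
open CategoryTheory Literature.AlgebraicGeometry Literature.AlgebraicGeometry.Motives
open Literature.AlgebraicGeometry.HodgeTheory Literature.AlgebraicTopology.SingularHomology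
open Literature.AlgebraicGeometry.Motives.HodgeStructure Literature.AlgebraicGeometry.Hyperkaehler
open Literature.AlgebraicGeometry.Surfaces
open Summit.HodgeConjecture.HodgeConjecture.Theorems.OddPrimeSquares
open Summit.HodgeConjecture.HodgeConjecture.Theorems.NikulinTwinTransport
open Summit.HodgeConjecture.HodgeConjecture.Theorems.MarkmanPartnerTransport.TranscendentalPresentation
open Summit.HodgeConjecture.HodgeConjecture.Theorems.MarkmanPartnerTransport.KugaSatakeSelf
open Summit.HodgeConjecture.HodgeConjecture.Theorems.MarkmanPartnerTransport.KugaSatakePair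
open Summit.HodgeConjecture.HodgeConjecture.Theorems.MarkmanPartnerTransport.KugaSatakeHK

variable {S X : SchemeOver ℂ} {φ : complexBetti X 2 ≃ₗ[ℂ] (K3HilbertIndex → ℂ)} {PX : complexBetti X (2 * 4)}
  {z : K3HilbertIndex → ℂ}

/-- `MarkedK3Sq[X, φ, P, z]`: VERBATIM the `let MarkedK3Sq := …` binder of the route declarations of
MarkmanPartnerTransport (clauses (m1)–(m6)). Local notation only. -/
local notation3 (prettyPrint := false) "MarkedK3Sq[" X ", " φ ", " P ", " z "]" =>
  (((IsIntegralClass P ∧ ∀ Q : complexBetti X (2 * 4), IsIntegralClass Q → ∃ n : ℤ, Q = n • P) ∧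
    (∀ c : complexBetti X 2, IsIntegralClass c ↔ ∃ v : K3HilbertIndex → ℤ, φ c = fun i => (v i : ℂ)) ∧
    (∀ a : complexBetti X 2, cupPowTwo a 4 = ((3 : ℂ) * (k3HilbertForm 2 (φ a) (φ a)) ^ 2) • P) ∧
    (IsOfHodgeType 4 X 2 2 0 (LinearEquiv.symm φ z) ∧
      ∀ τ : complexBetti X 2, IsOfHodgeType 4 X 2 2 0 τ → ∃ t : ℂ, τ = t • LinearEquiv.symm φ z) ∧
    (∀ c : complexBetti X 2, IsOfHodgeType 4 X 2 1 1 c ↔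
      (k3HilbertForm 2 (φ c) z = 0 ∧ k3HilbertForm 2 (φ c) (star z) = 0)) ∧
    (k3HilbertForm 2 z z = 0 ∧ 0 < (k3HilbertForm 2 (star z) z).re)))

/-- `H²[hS]`: the weight-two `ℚ`-Hodge structure on `H²(S(ℂ); ℚ)` of the real Hodge model of the surface `S`. -/
local notation3 "H²[" hS "]" =>
  bettiTwoHodgeStructure hS (BettiUniverse.realHodgeModel exists_isReal_hodgeModel_holds hS)
    (BettiUniverse.realHodgeModel_isHodgeSymmetric exists_isReal_hodgeModel_holds hS)

/-- `T[hS] = T(S)_ℚ = Hdg¹^⊥ ⊆ H²(S(ℂ); ℚ)`. -/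
local notation3 "T[" hS "]" =>
  transcendentalLatticeBetti hS (BettiUniverse.realHodgeModel exists_isReal_hodgeModel_holds hS)
    (BettiUniverse.realHodgeModel_isHodgeSymmetric exists_isReal_hodgeModel_holds hS)

/-- `H²_B[hX]`: the weight-two `ℚ`-Hodge structure on `H²(X(ℂ); ℚ)` of the real Hodge model of the fourfold `X`
(`hX : IsSmoothProjective (2 * 2) X`). -/
local notation3 "H²_B[" hX "]" =>
  bettiTwoHodgeStructureOfModel hX (BettiUniverse.realHodgeModel exists_isReal_hodgeModel_holds hX)
    (BettiUniverse.realHodgeModel_isHodgeSymmetric exists_isReal_hodgeModel_holds hX)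

/-- `Θ : ℂ ⊗_ℚ H²(Y(ℂ); ℚ) → H²(Y(ℂ); ℂ)` (`Y = S` or `X`). -/
local notation3 "Θ[" Y "]" => ofRatClassBaseChange (Motives.ComplexPoints Y) (2 * 1)

/-- `ι : H²(Y(ℂ); ℚ) → H²(Y(ℂ); ℂ)`, the rational lattice (`Y = S` or `X`). -/
local notation3 "ι[" Y "]" => ofRatClass (Motives.ComplexPoints Y) (2 * 1)

/-- `Transc[S, y]`: `y` is cup-orthogonal to `N¹(S) = algebraicClasses S 1`. Local notation only. -/
local notation3 (prettyPrint := false) "Transc[" S ", " y "]" =>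
  (∀ d ∈ algebraicClasses S 1, cupProduct (rfl : 2 * 1 + 2 * 1 = 2 * 2) y d = 0)

/-- `BBF[X, φ, y]`: `y` is `q`-orthogonal to `N¹(X) = algebraicClasses X 1` (the route's `IsBBFTransc`). -/
local notation3 (prettyPrint := false) "BBF[" X ", " φ ", " y "]" =>
  (∀ e : complexBetti X 2, e ∈ algebraicClasses X 1 → k3HilbertForm 2 (φ y) (φ e) = 0)

/-! ### §0 Morphisms of Hodge structures map an irreducible K3-type part into the transcendental part -/

/-- **A morphism of weight-two Hodge structures `Φ : H → H'` maps an IRREDUCIBLE sub-Hodge structure `T ⊆ H` with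
`T^{2,0} ≠ 0` into the transcendental part `T' ⊆ H'`** (`V'^{2,0} ⊆ T'_ℂ`): the kernel of `T → H' → H'/T'` is a
sub-Hodge structure of `T` (Voisin I, Lemma 7.25), so `0` or `T`; if `0`, the complexified map is injective and
carries `T^{2,0} ≠ 0` into `(H'/T')^{2,0} = π_ℂ(V'^{2,0}) = 0` — impossible. Two-structure form of gen 15's
`KugaSatakeHK.apply_mem_of_isTranscendentalPart_of_irreducible`. [cite: VoisinHodgeI2002, §7.3.1 Lemma 7.25]
[cite: Huybrechts2016K3, Ch. 3 §3.3 (Lemma 3.3.1)] -/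
theorem apply_mem_of_isTranscendentalPart_of_irreducible₂ {V W : Type*} [AddCommGroup V] [Module ℚ V]
    [AddCommGroup W] [Module ℚ W] {H : HodgeStructure V 2} {H' : HodgeStructure W 2}
    {T : SubHodgeStructure H} {T' : SubHodgeStructure H'} (hirr : T.toHodgeStructure.IsIrreducible)
    (h20 : T.toHodgeStructure.piece 2 0 ≠ ⊥) (htr' : H'.IsTranscendentalPart T') (Φ : Hom H H')
    {t : V} (ht : t ∈ T.toSubmodule) : Φ.toLinearMap t ∈ T'.toSubmodule := by
  set f : Hom T.toHodgeStructure (H'.quotient T') := T'.mkQHom.comp (Φ.comp T.subtypeHom) with hf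
  have hft : ∀ s : T.toSubmodule, f.toLinearMap s = T'.toSubmodule.mkQ (Φ.toLinearMap (s : V)) := fun s => rfl
  rcases hirr.eq_bot_or_eq_top f.ker with hbot | htop
  · exfalso
    have hinj : Function.Injective f.toLinearMap := by
      rw [← LinearMap.ker_eq_bot, ← Hom.ker_toSubmodule]
      exact hbot
    obtain ⟨x, hx, hx0⟩ := Submodule.exists_mem_ne_zero_of_ne_bot h20
    have h1 : f.toLinearMap.baseChange ℂ x ∈ (H'.quotient T').piece 2 0 := f.map_piece_le 2 0 ⟨x, hx, rfl⟩
    rw [mem_quotient_piece_iff] at h1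
    obtain ⟨y, hy, hyx⟩ := h1
    obtain ⟨u, hu⟩ : y ∈ T'.toSubmodule.baseChange ℂ := htr'.1 hy
    have hzero : T'.toSubmodule.mkQ.baseChange ℂ y = 0 := by
      rw [← hu]
      clear hu
      induction u using TensorProduct.induction_on with
      | zero => rw [map_zero, map_zero]
      | tmul c s =>
        rw [LinearMap.baseChange_tmul, Submodule.subtype_apply, LinearMap.baseChange_tmul, Submodule.mkQ_apply,
          (Submodule.Quotient.mk_eq_zero _).2 s.2, TensorProduct.tmul_zero]
      | add u₁ u₂ h₁ h₂ => rw [map_add, map_add, h₁, h₂, add_zero]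
    apply hx0
    apply Hom.baseChange_injective f hinj
    rw [← hyx, hzero, map_zero]
  · have hk : (⟨t, ht⟩ : T.toSubmodule) ∈ f.ker.toSubmodule := by rw [htop]; exact Submodule.mem_top
    rw [Hom.ker_toSubmodule, LinearMap.mem_ker, hft] at hk
    exact (Submodule.Quotient.mk_eq_zero _).1 hk

/-! ### §1 The surface presentation, with the transcendental-part clause -/

/-- **The transcendental part of a surface with `h^{2,0} = 1` is presented, and it is THE transcendental part of
`H²_B(S)`.** For `S` smooth projective with `(2,0)`-classes the line `ℂσ`, `σ ≠ 0`: a sub-Hodge structure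
`T ⊆ H²_B(S)` on `T(S)_ℚ = Hdg¹^⊥` which is the transcendental part (`V^{2,0} ⊆ T_ℂ`, minimal), irreducible and of
K3 type, with a polarization `P = ε∫` presenting it (`IsTranscendentalPartBetti`). Gen 14's
`exists_isTranscendentalPartBetti` through `exists_isTranscendentalPart_orthogonal_hodgeClasses`.
[cite: Huybrechts2016K3, Ch. 3 Def. 2.5, Lemma 2.7 and Lemma 3.1] [cite: vanGeemen2000KugaSatakeHC, §10.1–10.2] -/
theorem exists_isTranscendentalPartBetti_trPart (hS : IsSmoothProjective 2 S) {σ : complexBetti S (2 * 1)}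
    (hσ : IsOfHodgeType 2 S (2 * 1) 2 0 σ) (hσ0 : σ ≠ 0)
    (hline : ∀ c : complexBetti S (2 * 1), IsOfHodgeType 2 S (2 * 1) 2 0 c → ∃ t : ℂ, c = t • σ) :
    ∃ (T : SubHodgeStructure (H²[hS])) (P : T.toHodgeStructure.Polarization) (ε : ℤˣ),
      T.toSubmodule = T[hS] ∧ (H²[hS]).IsTranscendentalPart T ∧ T.toHodgeStructure.IsIrreducible ∧
      T.toHodgeStructure.IsOfK3Type ∧ IsTranscendentalPartBetti hS _ _ T.toHodgeStructure P ε T.subtypeHom := by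
  haveI : Module.Finite ℚ (bettiCohomology S (2 * 1)) := BettiUniverse.finite hS (2 * 1)
  have hK3 := isOfK3Type_bettiTwo hS hσ hσ0 hline
  obtain ⟨T, hT, htr⟩ := exists_isTranscendentalPart_orthogonal_hodgeClasses hK3 (cupPairingBetti hS)
    (cupPairingBetti_isSymm hS) (cupPairingBetti_nondegenerate hS) (hodge_F_apply_eq_zero hS)
    (cupPairingBetti_twoZero_conj_ne_zero hS)
  obtain ⟨hirr, hK3T, -⟩ :=
    Huybrechts_transcendentalPart_irreducible_holds _ hK3 (isPolarizable_bettiTwo hS) T htr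
  have hT' : T.toSubmodule = T[hS] := hT
  obtain ⟨ε, P, hP⟩ := exists_polarization_form_eq hS T hT'
  refine ⟨T, P, ε, hT', htr, hirr, hK3T, T.subtypeHom_injective, ?_, hP⟩
  rw [SubHodgeStructure.subtypeHom_toLinearMap, Submodule.range_subtype, hT']

/-! ### §2 Hodge descent of rational type-preserving maps `H²(S) → H²(X)` and `H²(X) → H²(S)` -/

/-- **A rational, type-preserving `g : H²(S(ℂ); ℂ) → H²(X(ℂ); ℂ)` (surface to fourfold) descends to a morphism of
Hodge structures `H²_B(S) → H²_B(X)`** (`ι_X ∘ G = g ∘ ι_S`; the filtrations `F^p = ⊕_{a ≥ p} Θ⁻¹H^{a,2-a}`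
correspond, types read in the real models). [cite: VoisinHodgeI2002, §7.3.1 and §7.1.1] -/
theorem exists_hom_ofRatClass_eq_SX (hS : IsSmoothProjective 2 S) (hX : IsSmoothProjective (2 * 2) X)
    (g : complexBetti S (2 * 1) →ₗ[ℂ] complexBetti X 2) (h1 : ∀ y, IsRationalClass y → IsRationalClass (g y))
    (h2 : ∀ (i j : ℕ) y, IsOfHodgeType 2 S (2 * 1) i j y → IsOfHodgeType 4 X 2 i j (g y)) :
    ∃ G : Hom (H²[hS]) (H²_B[hX]), ∀ v, ι[X] (G.toLinearMap v) = g (ι[S] v) := by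
  obtain ⟨Ψ, hΨ⟩ := exists_ratLinear_ofRatClass_eq₂ (S' := X) g h1
  set A := BettiUniverse.realHodgeModel exists_isReal_hodgeModel_holds hS with hA
  set A' := BettiUniverse.realHodgeModel exists_isReal_hodgeModel_holds hX with hA'
  have hI := hodgePQ_independent_of_hodgeModel_holds
  refine ⟨{ toLinearMap := Ψ, map_F_le := fun r => ?_ }, hΨ⟩
  rintro _ ⟨x, hx, rfl⟩
  have hF : (H²[hS]).F r = A.ratF hS (2 * 1) r := rfl
  have hF' : (H²_B[hX]).F r = A'.ratF hX (2 * 1) r := rfl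
  rw [SetLike.mem_coe, hF, HodgeModel.ratF_eq_iSup] at hx
  rw [hF', HodgeModel.ratF_eq_iSup]
  induction hx using Submodule.iSup_induction' with
  | mem pq x hx =>
    by_cases hr : r ≤ (pq.1.1 : ℤ)
    · rw [iSup_pos hr, HodgeModel.mem_ratPiece_iff, HodgeModel.complexification_apply] at hx
      have hty : IsOfHodgeType 2 S (2 * 1) pq.1.1 pq.1.2 (Θ[S] x) := ⟨A, hx⟩
      have hty' := h2 _ _ _ hty
      rw [← ofRatClassBaseChange_baseChange_eq₂ hΨ] at hty'
      obtain ⟨B', hB'⟩ := hty'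
      have h3 := hI (2 * 2) X hX B' A' (2 * 1) pq.1.1 pq.1.2 _ hB'
      refine Submodule.mem_iSup_of_mem pq (Submodule.mem_iSup_of_mem hr ?_)
      rw [HodgeModel.mem_ratPiece_iff, HodgeModel.complexification_apply]
      exact h3
    · rw [iSup_neg hr, Submodule.mem_bot] at hx
      rw [hx, map_zero]
      exact Submodule.zero_mem _
  | zero => rw [map_zero]; exact Submodule.zero_mem _
  | add x y _ _ hx hy => rw [map_add]; exact Submodule.add_mem _ hx hy

/-- **A rational, type-preserving `h : H²(X(ℂ); ℂ) → H²(S(ℂ); ℂ)` (fourfold to surface) descends to a morphism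
of Hodge structures `H²_B(X) → H²_B(S)`.** [cite: VoisinHodgeI2002, §7.3.1 and §7.1.1] -/
theorem exists_hom_ofRatClass_eq_XS (hS : IsSmoothProjective 2 S) (hX : IsSmoothProjective (2 * 2) X)
    (h : complexBetti X 2 →ₗ[ℂ] complexBetti S (2 * 1)) (h1 : ∀ y, IsRationalClass y → IsRationalClass (h y))
    (h2 : ∀ (i j : ℕ) y, IsOfHodgeType 4 X 2 i j y → IsOfHodgeType 2 S (2 * 1) i j (h y)) :
    ∃ G : Hom (H²_B[hX]) (H²[hS]), ∀ v, ι[S] (G.toLinearMap v) = h (ι[X] v) := by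
  obtain ⟨Ψ, hΨ⟩ := exists_ratLinear_ofRatClass_eq₂ (S := X) h h1
  set A := BettiUniverse.realHodgeModel exists_isReal_hodgeModel_holds hX with hA
  set A' := BettiUniverse.realHodgeModel exists_isReal_hodgeModel_holds hS with hA'
  have hI := hodgePQ_independent_of_hodgeModel_holds
  refine ⟨{ toLinearMap := Ψ, map_F_le := fun r => ?_ }, hΨ⟩
  rintro _ ⟨x, hx, rfl⟩
  have hF : (H²_B[hX]).F r = A.ratF hX (2 * 1) r := rfl
  have hF' : (H²[hS]).F r = A'.ratF hS (2 * 1) r := rfl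
  rw [SetLike.mem_coe, hF, HodgeModel.ratF_eq_iSup] at hx
  rw [hF', HodgeModel.ratF_eq_iSup]
  induction hx using Submodule.iSup_induction' with
  | mem pq x hx =>
    by_cases hr : r ≤ (pq.1.1 : ℤ)
    · rw [iSup_pos hr, HodgeModel.mem_ratPiece_iff, HodgeModel.complexification_apply] at hx
      have hty : IsOfHodgeType 4 X 2 pq.1.1 pq.1.2 (Θ[X] x) := ⟨A, hx⟩
      have hty' := h2 _ _ _ hty
      rw [← ofRatClassBaseChange_baseChange_eq₂ hΨ] at hty'
      obtain ⟨B', hB'⟩ := hty'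
      have h3 := hI 2 S hS B' A' (2 * 1) pq.1.1 pq.1.2 _ hB'
      refine Submodule.mem_iSup_of_mem pq (Submodule.mem_iSup_of_mem hr ?_)
      rw [HodgeModel.mem_ratPiece_iff, HodgeModel.complexification_apply]
      exact h3
    · rw [iSup_neg hr, Submodule.mem_bot] at hx
      rw [hx, map_zero]
      exact Submodule.zero_mem _
  | zero => rw [map_zero]; exact Submodule.zero_mem _
  | add x y _ _ hx hy => rw [map_add]; exact Submodule.add_mem _ hx hy

/-! ### §3 Restriction to the transcendental parts -/

/-- **`g_T : T(S)_ℚ → T(X)_ℚ` from `g`.** For `T ⊆ H²_B(S)` and `T' ⊆ H²_B(X)` with `T'` cut out by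
`q`-orthogonality to the rational Hodge classes, and `g` rational, type-preserving with `q`-transcendental image,
the descent of `g` restricts to `g_T : Hom T T'` with `(g_T t) ⊗ 1 = g(t ⊗ 1)`. [cite: VoisinHodgeI2002, §7.3.1]
[cite: Huybrechts2016K3, Ch. 3 Lemma 3.1] -/
theorem exists_hom_transcendental_SX (hS : IsSmoothProjective 2 S) (hX : IsSmoothProjective (2 * 2) X)
    (T : SubHodgeStructure (H²[hS])) (T' : SubHodgeStructure (H²_B[hX]))
    (hT' : ∀ x : bettiCohomology X (2 * 1), x ∈ T'.toSubmodule ↔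
      ∀ h ∈ (H²_B[hX]).hodgeClasses 1, k3HilbertForm 2 (φ (ι[X] x)) (φ (ι[X] h)) = 0)
    (g : complexBetti S (2 * 1) →ₗ[ℂ] complexBetti X 2) (h1 : ∀ y, IsRationalClass y → IsRationalClass (g y))
    (h2 : ∀ (i j : ℕ) y, IsOfHodgeType 2 S (2 * 1) i j y → IsOfHodgeType 4 X 2 i j (g y))
    (h4 : ∀ y : complexBetti S (2 * 1), BBF[X, φ, g y]) :
    ∃ gT : Hom T.toHodgeStructure T'.toHodgeStructure,
      ∀ t : T.toSubmodule, ι[X] ((gT.toLinearMap t : T'.toSubmodule) : bettiCohomology X (2 * 1)) =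
        g (ι[S] (t : bettiCohomology S (2 * 1))) := by
  obtain ⟨G, hG⟩ := exists_hom_ofRatClass_eq_SX hS hX g h1 h2
  have hmem : ∀ t : T.toSubmodule, (G.comp T.subtypeHom).toLinearMap t ∈ T'.toSubmodule := by
    intro t
    change G.toLinearMap (t : bettiCohomology S (2 * 1)) ∈ T'.toSubmodule
    rw [hT']
    intro h hh
    rw [hG]
    exact (bbfTransc_iff_hodgeClasses hX _).1 (h4 _) h hh
  exact ⟨(G.comp T.subtypeHom).codRestrict T' hmem, fun t => hG _⟩

/-- **`h_T : T(X)_ℚ → T(S)_ℚ` from `h`.** For `T' ⊆ H²_B(X)`, `T ⊆ H²_B(S)` on `T(S)_ℚ`, and `h : H²(X) → H²(S)`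
rational, type-preserving with cup-transcendental image, the descent restricts to `h_T : Hom T' T` with
`(h_T t') ⊗ 1 = h(t' ⊗ 1)`. [cite: VoisinHodgeI2002, §7.3.1] [cite: Huybrechts2016K3, Ch. 3 Lemma 3.1] -/
theorem exists_hom_transcendental_XS (hS : IsSmoothProjective 2 S) (hX : IsSmoothProjective (2 * 2) X)
    (T' : SubHodgeStructure (H²_B[hX])) (T : SubHodgeStructure (H²[hS])) (hT : T.toSubmodule = T[hS])
    (h : complexBetti X 2 →ₗ[ℂ] complexBetti S (2 * 1)) (h1 : ∀ y, IsRationalClass y → IsRationalClass (h y))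
    (h2 : ∀ (i j : ℕ) y, IsOfHodgeType 4 X 2 i j y → IsOfHodgeType 2 S (2 * 1) i j (h y))
    (h4 : ∀ y : complexBetti X 2, Transc[S, h y]) :
    ∃ hT : Hom T'.toHodgeStructure T.toHodgeStructure,
      ∀ t' : T'.toSubmodule, ι[S] ((hT.toLinearMap t' : T.toSubmodule) : bettiCohomology S (2 * 1)) =
        h (ι[X] (t' : bettiCohomology X (2 * 1))) := by
  obtain ⟨G, hG⟩ := exists_hom_ofRatClass_eq_XS hS hX h h1 h2
  have hmem : ∀ t' : T'.toSubmodule, (G.comp T'.subtypeHom).toLinearMap t' ∈ T.toSubmodule := by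
    intro t'
    have hm : G.toLinearMap (t' : bettiCohomology X (2 * 1)) ∈ T[hS] := by
      rw [mem_transcendental_iff_transc hS, hG]
      exact h4 _
    exact (le_of_eq hT.symm : T[hS] ≤ T.toSubmodule) hm
  exact ⟨(G.comp T'.subtypeHom).codRestrict T hmem, fun t' => hG _⟩

/-! ### §4 Bijectivity of `g_T` -/

/-- Every vector of `ℂ ⊗ T'` complexifies to a `q`-transcendental class (`T'` cut out by `q`-orthogonality to the
rational Hodge classes). [cite: Huybrechts2016K3, Ch. 3 Lemma 3.1] -/
theorem bbfTransc_of_baseChange (hX : IsSmoothProjective (2 * 2) X) (T' : SubHodgeStructure (H²_B[hX]))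
    (hT' : ∀ x : bettiCohomology X (2 * 1), x ∈ T'.toSubmodule ↔
      ∀ h ∈ (H²_B[hX]).hodgeClasses 1, k3HilbertForm 2 (φ (ι[X] x)) (φ (ι[X] h)) = 0)
    (x : ℂ ⊗[ℚ] T'.toSubmodule) : BBF[X, φ, Θ[X] (T'.toSubmodule.subtype.baseChange ℂ x)] := by
  intro e he
  induction x using TensorProduct.induction_on with
  | zero => rw [map_zero, map_zero, map_zero, bbf_zero_left]
  | tmul a t =>
    rw [LinearMap.baseChange_tmul, Submodule.subtype_apply, ofRatClassBaseChange_tmul, map_smul,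
      HkLatticeWitt.k3HilbertForm_smul_left, (bbfTransc_iff_hodgeClasses hX _).2 ((hT' _).1 t.2) e he, mul_zero]
  | add x y hx hy => rw [map_add, map_add, map_add, bbf_add_left, hx, hy, add_zero]

section Bijective

variable {hS : IsSmoothProjective 2 S} {hX : IsSmoothProjective (2 * 2) X}
  {T : SubHodgeStructure (H²[hS])} {T' : SubHodgeStructure (H²_B[hX])}
  {g : complexBetti S (2 * 1) →ₗ[ℂ] complexBetti X 2} {gT : Hom T.toHodgeStructure T'.toHodgeStructure}

/-- `g ∘ Θ_S ∘ (ι_T ⊗ ℂ) = Θ_X ∘ (ι_{T'} ⊗ ℂ) ∘ (g_T ⊗ ℂ)` on `ℂ ⊗ T`. [folklore] -/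
theorem apply_baseChange_eq_SX
    (hgT : ∀ t : T.toSubmodule, ι[X] ((gT.toLinearMap t : T'.toSubmodule) : bettiCohomology X (2 * 1)) =
      g (ι[S] (t : bettiCohomology S (2 * 1))))
    (x : ℂ ⊗[ℚ] T.toSubmodule) :
    g (Θ[S] (T.toSubmodule.subtype.baseChange ℂ x)) =
      Θ[X] (T'.toSubmodule.subtype.baseChange ℂ (gT.toLinearMap.baseChange ℂ x)) := by
  induction x using TensorProduct.induction_on with
  | zero => simp only [map_zero]
  | tmul c t =>
    rw [LinearMap.baseChange_tmul, Submodule.subtype_apply, ofRatClassBaseChange_tmul, map_smul,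
      LinearMap.baseChange_tmul, LinearMap.baseChange_tmul, Submodule.subtype_apply, ofRatClassBaseChange_tmul, hgT]
  | add x y hx hy => simp only [map_add, hx, hy]

/-- **`g_T : T(S)_ℚ → T(X)_ℚ` is BIJECTIVE** when `g` is injective on `T(S)_ℂ` and maps it onto `T(X)_ℂ`: injective
directly; `g_T ⊗ ℂ : ℂ ⊗ T → ℂ ⊗ T'` is bijective (`Θ(T_ℂ) = T(S)_ℂ`, `Θ'(T'_ℂ) = T(X)_ℂ`), so `dim_ℚ T = dim_ℚ T'`
and injective ⇒ surjective. [cite: Varesco2023, Def. 1.2] [cite: Huybrechts2016K3, Ch. 3 Lemma 3.1] -/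
theorem hom_transcendental_bijective_SX (hT : T.toSubmodule = T[hS])
    (hT' : ∀ x : bettiCohomology X (2 * 1), x ∈ T'.toSubmodule ↔
      ∀ h ∈ (H²_B[hX]).hodgeClasses 1, k3HilbertForm 2 (φ (ι[X] x)) (φ (ι[X] h)) = 0)
    (hgT : ∀ t : T.toSubmodule, ι[X] ((gT.toLinearMap t : T'.toSubmodule) : bettiCohomology X (2 * 1)) =
      g (ι[S] (t : bettiCohomology S (2 * 1))))
    (hinj : ∀ y : complexBetti S (2 * 1), Transc[S, y] → g y = 0 → y = 0)
    (hsurj : ∀ y' : complexBetti X 2, BBF[X, φ, y'] → ∃ y, Transc[S, y] ∧ g y = y') :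
    Function.Bijective gT.toLinearMap := by
  haveI := BettiUniverse.finite hS (2 * 1); haveI := BettiUniverse.finite hX (2 * 1)
  haveI := Module.Finite.of_injective T.toSubmodule.subtype T.toSubmodule.injective_subtype
  haveI := Module.Finite.of_injective T'.toSubmodule.subtype T'.toSubmodule.injective_subtype
  -- injective
  have hi : Function.Injective gT.toLinearMap := by
    rw [injective_iff_map_eq_zero]
    intro t ht
    have h0 : g (ι[S] (t : bettiCohomology S (2 * 1))) = 0 := by
      rw [← hgT, ht, Submodule.coe_zero, map_zero]
    have htr : Transc[S, ι[S] (t : bettiCohomology S (2 * 1))] :=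
      (mem_transcendental_iff_transc hS _).1 (hT ▸ t.2)
    have h1 := hinj _ htr h0
    apply Subtype.ext
    exact ofRatClass_injective (Y := Motives.ComplexPoints S) (2 * 1) (by rw [h1, Submodule.coe_zero, map_zero])
  -- the complexification is bijective
  have hIX : Function.Injective (fun x : ℂ ⊗[ℚ] T'.toSubmodule => Θ[X] (T'.toSubmodule.subtype.baseChange ℂ x)) :=
    fun x y hxy => baseChange_injective_of_injective T'.toSubmodule.injective_subtype
      (ofRatClassBaseChange_injective _ _ hxy)
  have hCinj : Function.Injective (gT.toLinearMap.baseChange ℂ) :=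
    baseChange_injective_of_injective hi
  have hCsurj : Function.Surjective (gT.toLinearMap.baseChange ℂ) := by
    intro x'
    obtain ⟨y, hy, hyx⟩ := hsurj _ (bbfTransc_of_baseChange hX T' hT' x')
    obtain ⟨x, rfl⟩ := exists_baseChange_eq_of_transc hS T hT hy
    refine ⟨x, hIX ?_⟩
    change Θ[X] (T'.toSubmodule.subtype.baseChange ℂ (gT.toLinearMap.baseChange ℂ x)) =
      Θ[X] (T'.toSubmodule.subtype.baseChange ℂ x')
    rw [← apply_baseChange_eq_SX hgT, hyx]
  have hdim : Module.finrank ℚ T.toSubmodule = Module.finrank ℚ T'.toSubmodule := by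
    rw [← Module.finrank_baseChange (R := ℂ) (S := ℚ), ← Module.finrank_baseChange (R := ℂ) (S := ℚ),
      (LinearEquiv.ofBijective _ ⟨hCinj, hCsurj⟩).finrank_eq]
  exact ⟨hi, (LinearMap.injective_iff_surjective_of_finrank_eq_finrank hdim).1 hi⟩

end Bijective

end Summit.HodgeConjecture.HodgeConjecture.Theorems.MarkmanPartnerTransport.KugaSatakeMixed

end
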